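/-
Copyright (c) 2026. All rights reserved.
Released under Apache 2.0 license as described in the file LICENSE.
-/
import Literature.NumberTheory.Weil1964.AdelicMetaplecticContinuous
import Literature.NumberTheory.Weil1964.AdelicOperatorsLF
import Literature.RepresentationTheory.HeisenbergGroup.SymplecticMatrixTransport
import HarnessLib

/-!
# The rational symplectic group lifts into the LF-continuous adelic metaplectic group

Fix a number field `F`, `n : ℕ` and an invertible duality matrix `T ∈ GL_n(𝔸_F)` (`IsUnit T.det`), so that
`W_𝔸 = X_𝔸 ⊕ Y_𝔸`, `X_𝔸 = Y_𝔸 = 𝔸_Fⁿ`, carries weil-1's symplectic form `polar (adelicForm F (Fin n) T)` and the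
adelic Schrödinger representation `adelicSchrodinger F (Fin n) T` on `𝒮(X_𝔸) = piSchwartzBruhat F (Fin n)`
(`AdelicHeisenbergSchrodinger`).  `AdelicMetaplecticGroup` built Weil's group `adelicMp = Mp_ψ(W_𝔸)` of implementing
pairs, its Θ-fixing subgroup `adelicMpTheta`, the Θ-liftable subgroup `adelicLiftable ≤ Sp(W_𝔸)` and the Θ-rigid lift
`adelicThetaLift`; `AdelicMetaplecticContinuous` cut everything down to LF-continuous operators (`adelicMpCont`,
`adelicLiftableCont`, `adelicThetaLiftCont`).

This file proves that **the whole rational symplectic group `Sp_{2n}(F)` is Θ-liftable with LF-continuous lift**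
and packages Weil's homomorphism

  `ratThetaLiftCont T hT : Sp_{2n}(F) →* Mp_ψ(W_𝔸)ᶜᵒⁿᵗ`,  `π ∘ ratThetaLiftCont = ratSp` (the embedding
  `Sp_{2n}(F) → Sp(W_𝔸)`), `Θ ∘ ω(ratThetaLiftCont γ) = Θ`,

i.e. the `i : Sp(W)(F) → Mp_𝐀(W)` of [GelbartRogawski1991, §3.1 p. 454] / Weil's `r_k : Sp(X_k) → Mp(X_A)`
[Weil1964, Chap. III n° 40 p. 190, n° 41 Thm 6 p. 193] in the model at hand — by EXHIBITING the three kinds of Siegel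
generators as explicit LF-continuous Θ-fixing implementers:

* Levi `m(a)`, `a ∈ GL_n(𝔸)`: the pair `(leviSp β_T a (T⁻¹a⁻ᵀT), Φ ↦ Φ ∘ a⁻¹)`; on functions `Φ ∘ a⁻¹ = twist (a⁻¹)ᵀ Φ`
  (row-vector convention of `AdelicThetaDistribution`), Θ-fixed for `a = γ ∈ GL_n(F)` (`thetaDist_twist_ratGL`),
  LF-continuous for every adelic `a` (`isLFContinuous_twistLM`);
* opposite unipotent `v(c)`, `c ∈ Sym_n(𝔸)`: `(unipotentSp β_T (T⁻¹c·), Φ ↦ ψ(-½ ᵗu c u) Φ)` = the chirp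
  `chirp (-½c)`, Θ-fixed for rational `c` (`thetaDist_chirp_ratMatrix`), LF-continuous always (`isLFContinuous_chirpLM`);
* the Weyl element `J`: `(weylSp β_T (-T·) (T⁻¹·), (fourierEquiv ν)⁻¹)` where `ν` is the self-dual Haar measure
  (`ν(D^n) = 1`) and `(fourierEquiv ν)⁻¹ Φ = u ↦ Φ̂(-u)` (theta-2's `AdelicThetaWeylElement`); condition (A) is weil-1's
  `weylFun_schrodinger` once `weylFun β_T ψ ν (-T·) Φ = Φ̂(-·)` is identified; Θ-fixed by Poisson summation
  (`fourierUnit_inv_mem_thetaStabilizer`), LF-continuous by `fourierEquiv_symm_mem_lfUnits`.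

Generation (`SymplecticSiegelGeneration`, Mathlib's big cell) and transport (`SymplecticMatrixTransport`,
`range_transportSp_mapHom_le`) then give `ratSp(Sp_{2n}(F)) ≤ adelicLiftableCont`.

Everything is kernel-checked; no record, no `Prop`-valued definition, no property of print is asserted — the cite tags
are provenance.  (pub-hodgecm mc lane W2, node J-RAT (r4) part 2/2.)
-/

noncomputable section

open scoped BigOperators NNReal ENNReal Matrix Classical
open NumberField NumberField.mixedEmbedding IsDedekindDomain MeasureTheory MeasureTheory.Measure

namespace Literature.NumberTheory.Weil1964

open Literature.NumberTheory.Automorphic Literature.RepresentationTheory.HeisenbergGroup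
  Literature.RepresentationTheory.HeisenbergGroup.SymplecticMatrix

attribute [local instance] secondCountableTopology_adeleRing locallyCompactSpace_adeleRing'

/-! ## §0. The contragredient `a ↦ (a⁻¹)ᵀ` on `GL` -/

section TrInv

variable {R : Type*} [CommRing R] {m : Type*} [Fintype m] [DecidableEq m]

/-- The contragredient `a ↦ (a⁻¹)ᵀ` as an element of `GL_m(R)` (inverse `aᵀ`). [folklore] -/
def trInv (a : GL m R) : GL m R where
  val := ((a⁻¹ : GL m R) : Matrix m m R)ᵀ
  inv := (a : Matrix m m R)ᵀ
  val_inv := by rw [← Matrix.transpose_mul, ← Units.val_mul, mul_inv_cancel, Units.val_one, Matrix.transpose_one]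
  inv_val := by rw [← Matrix.transpose_mul, ← Units.val_mul, inv_mul_cancel, Units.val_one, Matrix.transpose_one]

/-- `↑(trInv a) = (a⁻¹)ᵀ`. [folklore] -/
@[simp] theorem coe_trInv (a : GL m R) : ((trInv a : GL m R) : Matrix m m R) = ((a⁻¹ : GL m R) : Matrix m m R)ᵀ :=
  rfl

/-- `↑(trInv a)⁻¹ = aᵀ`. [folklore] -/
@[simp] theorem coe_trInv_inv (a : GL m R) : (((trInv a)⁻¹ : GL m R) : Matrix m m R) = (a : Matrix m m R)ᵀ := rfl

/-- `trInv` commutes with base change along a ring map. [folklore] -/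
theorem trInv_map {S : Type*} [CommRing S] (f : R →+* S) (a : GL m R) :
    trInv (Matrix.GeneralLinearGroup.map f a) = Matrix.GeneralLinearGroup.map f (trInv a) := by
  apply Units.ext
  show (((Matrix.GeneralLinearGroup.map f a)⁻¹ : GL m S) : Matrix m m S)ᵀ =
    (((a⁻¹ : GL m R) : Matrix m m R)ᵀ).map f
  rw [← map_inv, Matrix.transpose_map]
  rfl

end TrInv

variable (F : Type) [Field F] [NumberField F] {n : ℕ}

/-- `⅟2 = 2⁻¹ ∈ F ⊂ 𝔸_F` (the instance `invertibleTwoAdeleRing`). [folklore] -/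
theorem invOf_two_eq_algebraMap : (⅟(2 : AdeleRing (𝓞 F) F)) = algebraMap F (AdeleRing (𝓞 F) F) (2⁻¹ : F) := rfl

/-! ## §1. Levi elements: `Φ ↦ Φ ∘ a⁻¹` is the twist by `(a⁻¹)ᵀ` -/

section Levi

/-- weil-1's Levi operator of `a ∈ GL_n(𝔸)` (column convention, `Φ ↦ Φ(a⁻¹ ·)`) is the row-vector twist by `(a⁻¹)ᵀ`:
`Φ(a⁻¹ u) = Φ(u (a⁻¹)ᵀ)`. [cite: Weil1964, Chap. I n° 13 p. 160] -/
theorem leviOp_glEquiv (a : GL (Fin n) (AdeleRing (𝓞 F) F)) (f : (Fin n → AdeleRing (𝓞 F) F) → ℂ) :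
    leviOp (glEquiv a) f = twist F (trInv a) f := by
  funext u
  rw [leviOp_apply, glEquiv_symm_apply, twist_apply, coe_trInv, Matrix.vecMul_transpose]

/-- and its inverse `Φ ↦ Φ(a ·)` is the twist by `aᵀ = ((a⁻¹)ᵀ)⁻¹`. [cite: Weil1964, Chap. I n° 13 p. 160] -/
theorem leviOp_glEquiv_symm (a : GL (Fin n) (AdeleRing (𝓞 F) F)) (f : (Fin n → AdeleRing (𝓞 F) F) → ℂ) :
    (leviOp (glEquiv a)).symm f = twist F (trInv a)⁻¹ f := by
  funext u
  rw [leviOp_symm_apply, glEquiv_apply, twist_apply, coe_trInv_inv, Matrix.vecMul_transpose]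

variable (T : Matrix (Fin n) (Fin n) (AdeleRing (𝓞 F) F)) (hT : IsUnit T.det)
include hT

/-- **The Levi pair** `(m(a), Φ ↦ Φ ∘ a⁻¹)` as an element of `Mp_ψ(W_𝔸)`, `a ∈ GL_n(𝔸)`: condition (A) is weil-1's
`levi_mem_mpPairs`, restricted to `𝒮(X_𝔸)` (stable under twists, `twist_mem`). [cite: Weil1964, Chap. I n° 13 p. 160;
MoeglinVignerasWaldspurger1987, Chap. 2 II.6] -/
def leviPair (a : GL (Fin n) (AdeleRing (𝓞 F) F)) : adelicMp F (Fin n) T :=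
  ⟨(leviSp (adelicForm F (Fin n) T) (glEquiv a) (leviDual T hT a) (leviDual_compat T hT a),
    restrictEquiv (leviOp (glEquiv a)) (piSchwartzBruhat F (Fin n))
      (fun f hf => by rw [leviOp_glEquiv]; exact twist_mem hf _)
      (fun f hf => by rw [leviOp_glEquiv_symm]; exact twist_mem hf _)),
   (mem_MpPsi _ _).2 (by
      rw [ofSymplectic_leviSp]
      exact restrict_mem_mpPairs (adelicSchrodingerSub F (Fin n) T) _ _
        (levi_mem_mpPairs (adelicForm F (Fin n) T) (adeleAddChar F) (glEquiv a) (leviDual T hT a)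
          (leviDual_compat T hT a)))⟩

/-- `π(leviPair a) = m(a)`. [folklore] -/
@[simp] theorem proj_leviPair (a : GL (Fin n) (AdeleRing (𝓞 F) F)) :
    MpPsi.proj _ (leviPair F T hT a) =
      leviSp (adelicForm F (Fin n) T) (glEquiv a) (leviDual T hT a) (leviDual_compat T hT a) := rfl

/-- The operator of `leviPair a` on underlying functions is the twist by `(a⁻¹)ᵀ`. [folklore] -/
theorem coe_toOp_leviPair (a : GL (Fin n) (AdeleRing (𝓞 F) F)) (Φ : piSchwartzBruhat F (Fin n)) :
    ((MpPsi.toOp (adelicSchrodinger F (Fin n) T) (leviPair F T hT a) Φ : piSchwartzBruhat F (Fin n)) :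
        (Fin n → AdeleRing (𝓞 F) F) → ℂ) = twist F (trInv a) (Φ : (Fin n → AdeleRing (𝓞 F) F) → ℂ) :=
  leviOp_glEquiv F a _

/-- **Rational Levi pairs fix `Θ`**: for `a = γ ∈ GL_n(F)`, `Θ(Φ ∘ γ⁻¹) = Θ(Φ)` (`thetaDist_twist_ratGL` at `(γ⁻¹)ᵀ`).
[cite: Weil1964, Chap. III n° 41 Thm 6 p. 193] -/
theorem leviPair_ratGL_mem_adelicMpTheta (γ : GL (Fin n) F) :
    leviPair F T hT (ratGL F γ) ∈ adelicMpTheta F (Fin n) T := by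
  rw [mem_adelicMpTheta_iff]
  intro Φ
  rw [coe_toOp_leviPair, trInv_map]
  exact thetaDist_twist_ratGL _ (trInv γ)

/-- **Levi pairs are LF-continuous** (both the operator and its inverse are twists). [cite: Weil1964, Chap. I n° 13 p. 160]
-/
theorem leviPair_mem_adelicMpCont (a : GL (Fin n) (AdeleRing (𝓞 F) F)) :
    leviPair F T hT a ∈ adelicMpCont F (Fin n) T := by
  rw [mem_adelicMpCont_iff']
  exact ⟨(isLFContinuous_twistLM F (trInv a)).congr fun Φ => Subtype.ext (leviOp_glEquiv F a _),
    (isLFContinuous_twistLM F (trInv a)⁻¹).congr fun Φ => Subtype.ext (leviOp_glEquiv_symm F a _)⟩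

end Levi

/-! ## §2. Opposite unipotents: `Φ ↦ ψ(-½ ᵗu c u) Φ` is the chirp of `-½ c` -/

section Unipotent

/-- `-½ · (σ viewed in 𝔸) = (-½ σ) viewed in 𝔸` for a rational matrix `σ`. [folklore] -/
theorem neg_invOf_two_smul_ratMatrix (σ : Matrix (Fin n) (Fin n) F) :
    (-⅟(2 : AdeleRing (𝓞 F) F)) • ratMatrix F σ = ratMatrix F ((-(2⁻¹ : F)) • σ) := by
  ext i j
  simp only [Matrix.smul_apply, Matrix.map_apply, smul_eq_mul, map_mul, map_neg, invOf_two_eq_algebraMap]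

variable (T : Matrix (Fin n) (Fin n) (AdeleRing (𝓞 F) F)) (hT : IsUnit T.det)
include hT

/-- `-(½ β_T(u, T⁻¹ c u)) = q_{-½c}(u)`: the exponent of weil-1's unipotent operator for `b = T⁻¹ c` is the second-degree
form of `-½ c`. [folklore] -/
theorem neg_half_adelicForm_lowLin (c : Matrix (Fin n) (Fin n) (AdeleRing (𝓞 F) F)) (u : Fin n → AdeleRing (𝓞 F) F) :
    -(⅟(2 : AdeleRing (𝓞 F) F) * adelicForm F (Fin n) T u (lowLin T c u)) =
      sdForm F ((-⅟(2 : AdeleRing (𝓞 F) F)) • c) u := by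
  rw [adelicForm_apply, lowLin_apply, Matrix.mulVec_mulVec, ← Matrix.mul_assoc, Matrix.mul_nonsing_inv T hT,
    Matrix.one_mul, sdForm_apply, Matrix.vecMul_smul, smul_dotProduct, Matrix.dotProduct_mulVec, smul_eq_mul,
    neg_mul]

/-- `½ β_T(u, T⁻¹ c u) = q_{½c}(u)`. [folklore] -/
theorem half_adelicForm_lowLin (c : Matrix (Fin n) (Fin n) (AdeleRing (𝓞 F) F)) (u : Fin n → AdeleRing (𝓞 F) F) :
    ⅟(2 : AdeleRing (𝓞 F) F) * adelicForm F (Fin n) T u (lowLin T c u) = sdForm F ((⅟(2 : AdeleRing (𝓞 F) F)) • c) u := by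
  rw [adelicForm_apply, lowLin_apply, Matrix.mulVec_mulVec, ← Matrix.mul_assoc, Matrix.mul_nonsing_inv T hT,
    Matrix.one_mul, sdForm_apply, Matrix.vecMul_smul, smul_dotProduct, Matrix.dotProduct_mulVec, smul_eq_mul]

/-- weil-1's unipotent operator for `b = T⁻¹ c` IS the chirp `chirp (-½ c)` on all functions.
[cite: Weil1964, Chap. I n° 13 p. 160] -/
theorem unipotentOp_lowLin (c : Matrix (Fin n) (Fin n) (AdeleRing (𝓞 F) F)) (f : (Fin n → AdeleRing (𝓞 F) F) → ℂ) :
    unipotentOp (adeleAddChar F) (fun x => ⅟(2 : AdeleRing (𝓞 F) F) * adelicForm F (Fin n) T x (lowLin T c x)) f =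
      chirp F ((-⅟(2 : AdeleRing (𝓞 F) F)) • c) f := by
  funext u
  rw [unipotentOp_apply, chirp_apply, sdChar, neg_half_adelicForm_lowLin F T hT]

/-- and its inverse is the chirp `chirp (½ c)`. [cite: Weil1964, Chap. I n° 13 p. 160] -/
theorem unipotentOp_lowLin_symm (c : Matrix (Fin n) (Fin n) (AdeleRing (𝓞 F) F))
    (f : (Fin n → AdeleRing (𝓞 F) F) → ℂ) :
    (unipotentOp (adeleAddChar F) (fun x => ⅟(2 : AdeleRing (𝓞 F) F) * adelicForm F (Fin n) T x (lowLin T c x))).symm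
        f = chirp F ((⅟(2 : AdeleRing (𝓞 F) F)) • c) f := by
  funext u
  rw [unipotentOp_symm_apply, chirp_apply, sdChar, half_adelicForm_lowLin F T hT]

/-- **The unipotent pair** `(v(c), chirp(-½c))` as an element of `Mp_ψ(W_𝔸)`, `c ∈ Sym_n(𝔸)`: condition (A) is weil-1's
`unipotent_mem_mpPairs` (with `secondDegree_half`), restricted to `𝒮(X_𝔸)` (`chirp_mem`).
[cite: Weil1964, Chap. I n° 13 p. 160; MoeglinVignerasWaldspurger1987, Chap. 2 II.6] -/
def unipPair (c : Matrix (Fin n) (Fin n) (AdeleRing (𝓞 F) F)) (hc : c.IsSymm) : adelicMp F (Fin n) T :=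
  ⟨(unipotentSp (adelicForm F (Fin n) T) (lowLin T c) (lowLin_symm T hT c hc),
    restrictEquiv
      (unipotentOp (adeleAddChar F) fun x => ⅟(2 : AdeleRing (𝓞 F) F) * adelicForm F (Fin n) T x (lowLin T c x))
      (piSchwartzBruhat F (Fin n))
      (fun f hf => by rw [unipotentOp_lowLin F T hT]; exact chirp_mem hf _)
      (fun f hf => by rw [unipotentOp_lowLin_symm F T hT]; exact chirp_mem hf _)),
   (mem_MpPsi _ _).2 (by
      rw [ofSymplectic_unipotentSp]
      exact restrict_mem_mpPairs (adelicSchrodingerSub F (Fin n) T) _ _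
        (unipotent_mem_mpPairs (adelicForm F (Fin n) T) (adeleAddChar F) (lowLin T c) _
          (secondDegree_half (adelicForm F (Fin n) T) (lowLin T c) (lowLin_symm T hT c hc))))⟩

/-- `π(unipPair c) = v(c)`. [folklore] -/
@[simp] theorem proj_unipPair (c : Matrix (Fin n) (Fin n) (AdeleRing (𝓞 F) F)) (hc : c.IsSymm) :
    MpPsi.proj _ (unipPair F T hT c hc) = unipotentSp (adelicForm F (Fin n) T) (lowLin T c) (lowLin_symm T hT c hc) :=
  rfl

/-- The operator of `unipPair c` on underlying functions is `chirp (-½c)`. [folklore] -/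
theorem coe_toOp_unipPair (c : Matrix (Fin n) (Fin n) (AdeleRing (𝓞 F) F)) (hc : c.IsSymm)
    (Φ : piSchwartzBruhat F (Fin n)) :
    ((MpPsi.toOp (adelicSchrodinger F (Fin n) T) (unipPair F T hT c hc) Φ : piSchwartzBruhat F (Fin n)) :
        (Fin n → AdeleRing (𝓞 F) F) → ℂ) =
      chirp F ((-⅟(2 : AdeleRing (𝓞 F) F)) • c) (Φ : (Fin n → AdeleRing (𝓞 F) F) → ℂ) :=
  unipotentOp_lowLin F T hT c _

/-- **Rational unipotent pairs fix `Θ`**: for `c = σ ∈ Sym_n(F)`, `Θ(chirp(-½σ) Φ) = Θ(Φ)` (`thetaDist_chirp_ratMatrix`).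
[cite: Weil1964, Chap. III n° 41 Thm 6 p. 193] -/
theorem unipPair_ratMatrix_mem_adelicMpTheta (σ : Matrix (Fin n) (Fin n) F) (hσ : (ratMatrix F σ).IsSymm) :
    unipPair F T hT (ratMatrix F σ) hσ ∈ adelicMpTheta F (Fin n) T := by
  rw [mem_adelicMpTheta_iff]
  intro Φ
  rw [coe_toOp_unipPair, neg_invOf_two_smul_ratMatrix]
  exact thetaDist_chirp_ratMatrix _ _

/-- **Unipotent pairs are LF-continuous** (operator and inverse are chirps). [cite: Weil1964, Chap. I n° 13 p. 160] -/
theorem unipPair_mem_adelicMpCont (c : Matrix (Fin n) (Fin n) (AdeleRing (𝓞 F) F)) (hc : c.IsSymm) :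
    unipPair F T hT c hc ∈ adelicMpCont F (Fin n) T := by
  rw [mem_adelicMpCont_iff']
  exact ⟨(isLFContinuous_chirpLM F ((-⅟(2 : AdeleRing (𝓞 F) F)) • c)).congr fun Φ =>
      Subtype.ext (unipotentOp_lowLin F T hT c _),
    (isLFContinuous_chirpLM F ((⅟(2 : AdeleRing (𝓞 F) F)) • c)).congr fun Φ =>
      Subtype.ext (unipotentOp_lowLin_symm F T hT c _)⟩

end Unipotent

/-! ## §3. The Weyl element: `(fourierEquiv ν)⁻¹` implements `J` -/

section Weyl

/-- A self-dual Haar measure exists: some Haar measure gives the Tate domain `D^n` mass `1`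
(`measure_piFundamentalDomain_toReal_pos`, rescale). [folklore] -/
theorem exists_haar_measure_piFundamentalDomain_eq_one [MeasurableSpace (AdeleRing (𝓞 F) F)]
    [BorelSpace (AdeleRing (𝓞 F) F)] :
    ∃ ν : Measure (Fin n → AdeleRing (𝓞 F) F), ν.IsAddHaarMeasure ∧ ν (piFundamentalDomain F (Fin n)) = 1 := by
  haveI : BorelSpace (Fin n → AdeleRing (𝓞 F) F) := Pi.borelSpace
  obtain ⟨h0, htop⟩ := ENNReal.toReal_pos_iff.1
    (measure_piFundamentalDomain_toReal_pos (ν := (addHaar : Measure (Fin n → AdeleRing (𝓞 F) F))))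
  refine ⟨(addHaar (piFundamentalDomain F (Fin n)))⁻¹ • addHaar,
    IsAddHaarMeasure.smul _ (ENNReal.inv_ne_zero.2 htop.ne) (ENNReal.inv_ne_top.2 h0.ne'), ?_⟩
  rw [Measure.smul_apply, smul_eq_mul, ENNReal.inv_mul_cancel h0.ne' htop.ne]

variable (T : Matrix (Fin n) (Fin n) (AdeleRing (𝓞 F) F)) (hT : IsUnit T.det)
include hT

/-- `(weylGamma)⁻¹ u = T⁻¹(-u)`. [folklore] -/
theorem weylGamma_symm_apply (u : Fin n → AdeleRing (𝓞 F) F) : (weylGamma T hT).symm u = T⁻¹ *ᵥ (-u) := by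
  rw [LinearEquiv.symm_apply_eq, weylGamma_apply, Matrix.mulVec_mulVec, Matrix.mul_nonsing_inv T hT,
    Matrix.one_mulVec, neg_neg]

variable [MeasurableSpace (AdeleRing (𝓞 F) F)] [BorelSpace (AdeleRing (𝓞 F) F)]
  (ν : Measure (Fin n → AdeleRing (𝓞 F) F))

omit [BorelSpace (AdeleRing (𝓞 F) F)] in
/-- **weil-1's Weyl operator for `γ = -T·` is `Φ ↦ Φ̂(-·)`**: `∫ ψ(β_T(v, γ⁻¹u)) Φ(v) dν(v) = Φ̂_ν(-u)` since
`β_T(v, T⁻¹(-u)) = -v·u`. [cite: Weil1964, Chap. I n° 13 p. 160] -/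
theorem weylFun_weylGamma (f : (Fin n → AdeleRing (𝓞 F) F) → ℂ) :
    weylFun (adelicForm F (Fin n) T) (adeleAddChar F) ν (weylGamma T hT) f =
      fun u => adelicPiFourier F (Fin n) ν f (-u) := by
  funext u
  rw [weylFun_apply, adelicPiFourier_apply]
  congr 1
  funext v
  have h : adelicForm F (Fin n) T v ((weylGamma T hT).symm u) = ∑ i, (-u) i * v i := by
    rw [weylGamma_symm_apply F T hT, adelicForm_apply, Matrix.mulVec_mulVec, Matrix.mul_nonsing_inv T hT,
      Matrix.one_mulVec, dotProduct_comm]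
    rfl
  rw [h, mul_comm]

variable [ν.IsAddHaarMeasure]

/-- **The Weyl pair** `(J_T, (fourierEquiv ν)⁻¹)` as an element of `Mp_ψ(W_𝔸)` for the self-dual Haar measure `ν`
(`ν(D^n) = 1`): condition (A) is weil-1's `weylFun_schrodinger` transported through `weylFun_weylGamma` and theta-2's
`coe_fourierEquiv_symm`. [cite: Weil1964, Chap. I n° 13 p. 160; MoeglinVignerasWaldspurger1987, Chap. 2 II.6] -/
def weylPair (hν : ν (piFundamentalDomain F (Fin n)) = 1) : adelicMp F (Fin n) T :=
  ⟨(weylSp (adelicForm F (Fin n) T) (weylGamma T hT) (gramEquiv T hT).symm (weylGamma_compat T hT),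
    (fourierEquiv F (Fin n) ν hν).symm),
   (mem_MpPsi _ _).2 (by
      rw [ofSymplectic_weylSp]
      intro h Φ
      apply Subtype.ext
      rw [coe_fourierEquiv_symm, coe_adelicSchrodinger, coe_adelicSchrodinger, coe_fourierEquiv_symm,
        ← weylFun_weylGamma F T hT ν, ← weylFun_weylGamma F T hT ν]
      exact weylFun_schrodinger (adelicForm F (Fin n) T) (adeleAddChar F) ν (weylGamma T hT) (gramEquiv T hT).symm
        (weylGamma_compat T hT) h _)⟩

/-- `π(weylPair) = J_T`. [folklore] -/
@[simp] theorem proj_weylPair (hν : ν (piFundamentalDomain F (Fin n)) = 1) :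
    MpPsi.proj _ (weylPair F T hT ν hν) =
      weylSp (adelicForm F (Fin n) T) (weylGamma T hT) (gramEquiv T hT).symm (weylGamma_compat T hT) := rfl

/-- The operator of `weylPair` is `(fourierEquiv ν)⁻¹`. [folklore] -/
@[simp] theorem toOp_weylPair (hν : ν (piFundamentalDomain F (Fin n)) = 1) :
    MpPsi.toOp (adelicSchrodinger F (Fin n) T) (weylPair F T hT ν hν) = (fourierEquiv F (Fin n) ν hν).symm := rfl

/-- **The Weyl pair fixes `Θ`** (Poisson summation: theta-2's `fourierUnit_inv_mem_thetaStabilizer`).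
[cite: Weil1964, Chap. III n° 41 Thm 6 p. 193; CasselsFrohlichANT1967, Ch. XV Thm. 4.2.1] -/
theorem weylPair_mem_adelicMpTheta (hν : ν (piFundamentalDomain F (Fin n)) = 1) :
    weylPair F T hT ν hν ∈ adelicMpTheta F (Fin n) T := by
  rw [mem_adelicMpTheta_iff_thetaStabilizer, toOp_weylPair]
  have h : LinearMap.GeneralLinearGroup.ofLinearEquiv (fourierEquiv F (Fin n) ν hν).symm =
      (fourierUnit F (Fin n) ν hν)⁻¹ :=
    Units.ext (LinearMap.ext fun _ => rfl)
  rw [h]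
  exact fourierUnit_inv_mem_thetaStabilizer hν

/-- **The Weyl pair is LF-continuous** (`fourierEquiv_symm_mem_lfUnits`). [cite: Weil1964, Chap. I n° 13 p. 160] -/
theorem weylPair_mem_adelicMpCont (hν : ν (piFundamentalDomain F (Fin n)) = 1) :
    weylPair F T hT ν hν ∈ adelicMpCont F (Fin n) T :=
  (mem_adelicMpCont_iff _).2 (fourierEquiv_symm_mem_lfUnits hν)

end Weyl

/-! ## §4. `Sp_{2n}(F)` is Θ-liftable with LF-continuous lift; the homomorphism `ratThetaLiftCont` -/

section Rational

variable (T : Matrix (Fin n) (Fin n) (AdeleRing (𝓞 F) F)) (hT : IsUnit T.det)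
include hT

/-- `y ↦ T y` is onto for `IsUnit T.det` (the hypothesis shape of `AdelicMetaplecticGroup`). [folklore] -/
theorem mulVec_surjective_of_isUnit_det : Function.Surjective fun y : Fin n → AdeleRing (𝓞 F) F => T *ᵥ y :=
  mulVec_surjective_of_isUnit ((Matrix.isUnit_iff_isUnit_det T).2 hT)

/-- **The rational symplectic group inside `Sp(W_𝔸)`**: `Sp_{2n}(F) → Sp_{2n}(𝔸_F) → Sp(W_𝔸, polar β_T)`
(`mapHom (algebraMap F 𝔸_F)` then `transportSp T`). [cite: Weil1964, Chap. III n° 37 p. 188] -/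
def ratSp : Matrix.symplecticGroup (Fin n) F →* symplecticGroup (polar (adelicForm F (Fin n) T)) :=
  (transportSp T hT).comp (mapHom (algebraMap F (AdeleRing (𝓞 F) F)))

/-- `ratSp (m(γ))` is weil-1's Levi element of `γ` (viewed in `GL_n(𝔸)`). [folklore] -/
theorem ratSp_levi (γ : GL (Fin n) F) :
    ratSp F T hT (levi γ) = leviSp (adelicForm F (Fin n) T) (glEquiv (ratGL F γ)) (leviDual T hT (ratGL F γ))
      (leviDual_compat T hT (ratGL F γ)) := by
  rw [ratSp, MonoidHom.comp_apply, mapHom_levi, transportSp_levi]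

/-- `ratSp (v(σ))` is weil-1's unipotent element of `T⁻¹σ`. [folklore] -/
theorem ratSp_low [Invertible (2 : F)] (σ : Matrix (Fin n) (Fin n) F) (hσ : σ.IsSymm) :
    ratSp F T hT (low σ hσ) = unipotentSp (adelicForm F (Fin n) T) (lowLin T (ratMatrix F σ))
      (lowLin_symm T hT (ratMatrix F σ) (hσ.map _)) := by
  rw [ratSp, MonoidHom.comp_apply, mapHom_low, transportSp_low]

/-- `ratSp J` is weil-1's Weyl element `(-T·, T⁻¹·)`. [folklore] -/
theorem ratSp_J [Invertible (2 : F)] :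
    ratSp F T hT (SymplecticGroup.symJ (Fin n) F) =
      weylSp (adelicForm F (Fin n) T) (weylGamma T hT) (gramEquiv T hT).symm (weylGamma_compat T hT) := by
  rw [ratSp, MonoidHom.comp_apply, mapHom_J, transportSp_J]

/-- **The Θ-liftable elements with LF-continuous lift, as a subgroup of `Sp(W_𝔸)`** (image of `adelicLiftableCont`).
[cite: Weil1964, Chap. III n° 40 p. 190] -/
def adelicLiftableContSp : Subgroup (symplecticGroup (polar (adelicForm F (Fin n) T))) :=
  (adelicLiftableCont T (mulVec_surjective_of_isUnit_det F T hT)).map (adelicLiftable F (Fin n) T).subtype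

variable {T hT} in
/-- Membership: `g ∈ adelicLiftableContSp ↔ g` is Θ-liftable and its Θ-lift is LF-continuous. [folklore] -/
theorem mem_adelicLiftableContSp_iff (g : symplecticGroup (polar (adelicForm F (Fin n) T))) :
    g ∈ adelicLiftableContSp F T hT ↔ ∃ hg : g ∈ adelicLiftable F (Fin n) T,
      (⟨g, hg⟩ : adelicLiftable F (Fin n) T) ∈ adelicLiftableCont T (mulVec_surjective_of_isUnit_det F T hT) := by
  constructor
  · rintro ⟨x, hx, rfl⟩
    exact ⟨x.2, hx⟩
  · rintro ⟨hg, h⟩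
    exact ⟨⟨g, hg⟩, h, rfl⟩

variable {T hT} in
/-- Criterion: an explicit Θ-fixing LF-continuous pair over `g` puts `g` in `adelicLiftableContSp`. [folklore] -/
theorem mem_adelicLiftableContSp_of_mem {p : adelicMp F (Fin n) T} (hΘ : p ∈ adelicMpTheta F (Fin n) T)
    (hc : p ∈ adelicMpCont F (Fin n) T) : MpPsi.proj _ p ∈ adelicLiftableContSp F T hT :=
  ⟨_, mem_adelicLiftableCont_of_mem _ hΘ hc, rfl⟩

/-- **Main theorem: the rational symplectic group is Θ-liftable with LF-continuous lift**,
`ratSp(Sp_{2n}(F)) ≤ adelicLiftableContSp` — generation by `m(γ), v(σ), J` (`range_transportSp_mapHom_le`) and the three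
explicit pairs of §1–§3 (the Weyl pair for a self-dual Haar measure, which exists).
[cite: Weil1964, Chap. III n° 40 p. 190, n° 41 Thm 6 p. 193; GelbartRogawski1991, §3.1 p. 454] -/
theorem range_ratSp_le : (ratSp F T hT).range ≤ adelicLiftableContSp F T hT := by
  letI : MeasurableSpace (AdeleRing (𝓞 F) F) := borel _
  haveI : BorelSpace (AdeleRing (𝓞 F) F) := ⟨rfl⟩
  obtain ⟨ν, hνH, hν⟩ := exists_haar_measure_piFundamentalDomain_eq_one F (n := n)
  refine range_transportSp_mapHom_le (algebraMap F (AdeleRing (𝓞 F) F)) T hT ?_ ?_ ?_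
  · intro a
    exact mem_adelicLiftableContSp_of_mem F (leviPair_ratGL_mem_adelicMpTheta F T hT a)
      (leviPair_mem_adelicMpCont F T hT _)
  · intro c hc
    exact mem_adelicLiftableContSp_of_mem F (unipPair_ratMatrix_mem_adelicMpTheta F T hT c (hc.map _))
      (unipPair_mem_adelicMpCont F T hT _ _)
  · exact mem_adelicLiftableContSp_of_mem F (weylPair_mem_adelicMpTheta F T hT ν hν)
      (weylPair_mem_adelicMpCont F T hT ν hν)

/-- every rational symplectic element is Θ-liftable with LF-continuous lift. [cite: Weil1964, Chap. III n° 40 p. 190] -/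
theorem ratSp_mem (g : Matrix.symplecticGroup (Fin n) F) : ratSp F T hT g ∈ adelicLiftableContSp F T hT :=
  range_ratSp_le F T hT ⟨g, rfl⟩

/-- `Sp_{2n}(F) →* adelicLiftableCont` (the embedding `ratSp` with its target refined). [folklore] -/
def ratSpLiftableCont :
    Matrix.symplecticGroup (Fin n) F →* adelicLiftableCont T (mulVec_surjective_of_isUnit_det F T hT) :=
  ((ratSp F T hT).codRestrict (adelicLiftable F (Fin n) T) fun g =>
      ((mem_adelicLiftableContSp_iff F _).1 (ratSp_mem F T hT g)).fst).codRestrict _ fun g =>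
    ((mem_adelicLiftableContSp_iff F _).1 (ratSp_mem F T hT g)).snd

/-- `ratSpLiftableCont g` is `ratSp g` as an element of `Sp(W_𝔸)`. [folklore] -/
@[simp] theorem coe_coe_ratSpLiftableCont (g : Matrix.symplecticGroup (Fin n) F) :
    ((ratSpLiftableCont F T hT g : adelicLiftable F (Fin n) T) : symplecticGroup (polar (adelicForm F (Fin n) T))) =
      ratSp F T hT g := rfl

/-- **Weil's homomorphism `r_F` / Gelbart–Rogawski's `i` on `Sp(W)(F)`**: the Θ-rigid LF-continuous lift
`Sp_{2n}(F) →* Mp_ψ(W_𝔸)ᶜᵒⁿᵗ`, `γ ↦` the unique Θ-fixing implementing pair over `ratSp γ`.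
[cite: Weil1964, Chap. III n° 40 p. 190, n° 41 Thm 6 p. 193; GelbartRogawski1991, §3.1 p. 454] -/
def ratThetaLiftCont : Matrix.symplecticGroup (Fin n) F →* adelicMpCont F (Fin n) T :=
  (adelicThetaLiftCont T (mulVec_surjective_of_isUnit_det F T hT)).comp (ratSpLiftableCont F T hT)

/-- `ratThetaLiftCont γ`, as an element of `Mp_ψ(W_𝔸)`, is the Θ-lift of `ratSp γ`. [folklore] -/
theorem coe_ratThetaLiftCont (g : Matrix.symplecticGroup (Fin n) F) :
    (ratThetaLiftCont F T hT g : adelicMp F (Fin n) T) =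
      adelicThetaLift T (mulVec_surjective_of_isUnit_det F T hT) (ratSpLiftableCont F T hT g) := rfl

/-- **`π ∘ r_F = ratSp`**: the lift lies over the rational symplectic group. [cite: Weil1964, Chap. III n° 40 p. 190] -/
@[simp] theorem proj_ratThetaLiftCont (g : Matrix.symplecticGroup (Fin n) F) :
    adelicMpCont.proj F (Fin n) T (ratThetaLiftCont F T hT g) = ratSp F T hT g :=
  proj_adelicThetaLiftCont (mulVec_surjective_of_isUnit_det F T hT) (ratSpLiftableCont F T hT g)

/-- `π(r_F(γ)) = ratSp γ` at the level of `Mp_ψ(W_𝔸)`. [cite: Weil1964, Chap. III n° 40 p. 190] -/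
theorem proj_coe_ratThetaLiftCont (g : Matrix.symplecticGroup (Fin n) F) :
    MpPsi.proj _ (ratThetaLiftCont F T hT g : adelicMp F (Fin n) T) = ratSp F T hT g :=
  proj_adelicThetaLift T (mulVec_surjective_of_isUnit_det F T hT)
    (ratSpLiftableCont F T hT g : adelicLiftable F (Fin n) T)

/-- **`Θ ∘ ω(r_F(γ)) = Θ`**: the lifted operators fix the theta distribution. [cite: Weil1964, Chap. III n° 41 Thm 6 p. 193]
-/
theorem thetaDist_omega_ratThetaLiftCont (g : Matrix.symplecticGroup (Fin n) F) (Φ : piSchwartzBruhat F (Fin n)) :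
    thetaDist F (Fin n) ((adelicMpCont.omega F (Fin n) T (ratThetaLiftCont F T hT g) Φ : piSchwartzBruhat F (Fin n)) :
        (Fin n → AdeleRing (𝓞 F) F) → ℂ) = thetaDist F (Fin n) (Φ : (Fin n → AdeleRing (𝓞 F) F) → ℂ) :=
  thetaDist_omega_adelicThetaLiftCont _ _ Φ

/-- `ratThetaLiftCont γ` fixes `Θ` (membership form). [cite: Weil1964, Chap. III n° 41 Thm 6 p. 193] -/
theorem coe_ratThetaLiftCont_mem_adelicMpTheta (g : Matrix.symplecticGroup (Fin n) F) :
    (ratThetaLiftCont F T hT g : adelicMp F (Fin n) T) ∈ adelicMpTheta F (Fin n) T :=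
  adelicThetaLift_mem T (mulVec_surjective_of_isUnit_det F T hT) (ratSpLiftableCont F T hT g)

/-- **Uniqueness (Θ-rigidity)**: a Θ-fixing pair over `ratSp γ` IS `ratThetaLiftCont γ`.
[cite: Weil1964, Chap. III n° 40 p. 190] -/
theorem coe_ratThetaLiftCont_eq {g : Matrix.symplecticGroup (Fin n) F} {p : adelicMp F (Fin n) T}
    (hΘ : p ∈ adelicMpTheta F (Fin n) T) (hp : MpPsi.proj _ p = ratSp F T hT g) :
    (ratThetaLiftCont F T hT g : adelicMp F (Fin n) T) = p :=
  adelicMp_eq_of_proj_eq (mulVec_surjective_of_isUnit_det F T hT) (coe_ratThetaLiftCont_mem_adelicMpTheta F T hT g)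
    hΘ ((proj_coe_ratThetaLiftCont F T hT g).trans hp.symm)

/-- **Explicit value on Levi generators**: `r_F(m(γ)) = (m(γ), Φ ↦ Φ ∘ γ⁻¹)`. [cite: Weil1964, Chap. I n° 13 p. 160] -/
theorem coe_ratThetaLiftCont_levi (γ : GL (Fin n) F) :
    (ratThetaLiftCont F T hT (levi γ) : adelicMp F (Fin n) T) = leviPair F T hT (ratGL F γ) :=
  coe_ratThetaLiftCont_eq F T hT (leviPair_ratGL_mem_adelicMpTheta F T hT γ) ((proj_leviPair F T hT _).trans (ratSp_levi F T hT γ).symm)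

/-- **Explicit value on unipotent generators**: `r_F(v(σ)) = (v(σ), chirp(-½σ))`. [cite: Weil1964, Chap. I n° 13 p. 160]
-/
theorem coe_ratThetaLiftCont_low (σ : Matrix (Fin n) (Fin n) F) (hσ : σ.IsSymm) :
    (ratThetaLiftCont F T hT (low σ hσ) : adelicMp F (Fin n) T) = unipPair F T hT (ratMatrix F σ) (hσ.map _) :=
  coe_ratThetaLiftCont_eq F T hT (unipPair_ratMatrix_mem_adelicMpTheta F T hT σ _) ((proj_unipPair F T hT _ _).trans (ratSp_low F T hT σ hσ).symm)

/-- **Explicit value on the Weyl element**: `r_F(J) = (J_T, (fourierEquiv ν)⁻¹)` for ANY self-dual Haar measure `ν`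
(in particular the operator does not depend on the choice). [cite: Weil1964, Chap. I n° 13 p. 160] -/
theorem coe_ratThetaLiftCont_J [MeasurableSpace (AdeleRing (𝓞 F) F)] [BorelSpace (AdeleRing (𝓞 F) F)]
    (ν : Measure (Fin n → AdeleRing (𝓞 F) F)) [ν.IsAddHaarMeasure] (hν : ν (piFundamentalDomain F (Fin n)) = 1) :
    (ratThetaLiftCont F T hT (SymplecticGroup.symJ (Fin n) F) : adelicMp F (Fin n) T) =
      weylPair F T hT ν hν :=
  coe_ratThetaLiftCont_eq F T hT (weylPair_mem_adelicMpTheta F T hT ν hν) ((proj_weylPair F T hT ν hν).trans (ratSp_J F T hT).symm)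

end Rational

end Literature.NumberTheory.Weil1964

end
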